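import Literature.Barriers.NavierStokesRegularity.NavierStokesInequalityProfiles
import Literature.Barriers.NavierStokesRegularity.NavierStokesInequalitySwirlLaplacian
import Literature.Barriers.NavierStokesRegularity.NavierStokesInequalitySwirlTimeDependent
import Literature.Barriers.NavierStokesRegularity.NavierStokesInequalityStructureBasics
import Literature.Analysis.FluidPDE.ClassicalSolutionCalculus
import HarnessLib

/-!
# Scheffer's block from planar profiles, II: the time slices and the space–time smoothness

Barrier catalogue support file for `NavierStokesRegularity` (D-0021), on the proof path of fact
D-I `Literature.Barriers.NavierStokesRegularity.NSIBlock_of_profiles`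
(`NavierStokesInequalityProfiles`; Scheffer 1985, Lemma 2.1; Ożański 2017, §4.1–4.2). The field
of the block is `u(t) = u[a₁(t)v₁, Q₁(t)] + u[a₂(t)v₂, Q₂(t)]` (`profileField`); its time slices
are fields `u[w, g]` whose planar data `(w, g) = (a(t)v, Q(t))` satisfy, at each time, exactly
Scheffer's (2.3)–(2.5), (2.9) — NOT Ożański's Definition 3.3 of a structure (no cut-off `φ`, no
sign of `Lg`; `(aᵢᵏvᵢ, qᵏᵢ,ₜ, φᵢ)` is a structure in print, (4.20), but the tree's
`IsNSIProfileData` does not and need not carry `L(Qᵢ) > 0` off `{φᵢ = 1}`). This file therefore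

* isolates the slice hypotheses as `IsNSISlice U w g` (Scheffer (2.2)–(2.5), (2.9) at a fixed
  time: `Ū ⋐ P`, `w ∈ C_c^∞(U)`, `g ∈ C^∞`, `g ≥ 0`, `g = 0` off `Ū`, `g > |w|` on `U`,
  `div(x₂w) = 0` on `U`), records `IsNSIStructure → IsNSISlice` and
  `IsNSIProfileData → IsNSISlice` at every `t ∈ (-η, T+η)` (`IsNSIProfileData.slice₁/₂`);
* re-derives for slices the calculus of `NavierStokesInequalitySwirlCalculus`/`…SwirlLaplacian`
  (there stated for structures): `u[w,g] ∈ C_c^∞` with `supp ⊆ R(Ū)` (Scheffer (2.12)),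
  `div u[w,g] = 0` (Ożański Lemma 3.1 (i)), `|u[w,g]| = g∘R⁻¹` everywhere ((3.11)),
  `Δu[w,g] = (Lg)φ̂` and `u·Δu = gLg` off `supp w` (Lemma 3.1 (ii), (3.31); Scheffer (2.20));
* proves `tsupport_swirlField` (`supp u[w,g] = R(Ū)` exactly, with the tree's
  `closure_revolve_eq` of `NavierStokesInequalityStructureBasics`);
* records the JOINT smoothness `IsNSIProfileData.isSmoothSpaceTimeOn_profileField`:
  `u ∈ C^∞(ℝ³ × (-η,T+η))` (Ożański §4.2: "the smoothness of `u` … follow[s] directly from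
  (4.20), the smoothness of the oscillatory processes … and from the smoothness of `q₁ᵏ, q₂ᵏ`";
  Scheffer (2.12): "`uⁱ` is a `C^∞` function on `ℝ³ × J`"), from the tree's
  `isSmoothSpaceTimeOn_swirlField_param` (`NavierStokesInequalitySwirlTimeDependent`).

## References

* V. Scheffer, Comm. Math. Phys. 101 (1985), Lemma 2.1: (2.2)–(2.5), (2.9), (2.12),
  (2.19)–(2.22). [`Scheffer1985`]
* W. S. Ożański, arXiv:1709.00602v4, §3.3 (Lemma 3.1, (3.11)), §3.4 ((3.29)–(3.31)), §4.1
  ((4.17)–(4.20)), §4.2 (first paragraph). [`Ozanski2017NSISingular`]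
-/

noncomputable section

open MeasureTheory Set Function Filter Topology TopologicalSpace WithLp Metric
open scoped ENNReal InnerProductSpace RealInnerProductSpace ContDiff Laplacian

namespace Literature.Barriers.NavierStokesRegularity

open Literature.Analysis.FluidPDE

/-- Local notation for physical space `ℝ³ = EuclideanSpace ℝ (Fin 3)`. -/
local notation "ℝ³" => EuclideanSpace ℝ (Fin 3)

/-! ### Slice data (Scheffer 1985, (2.2)–(2.5), (2.9) at a fixed time) -/

/-- **Slice data**: the hypotheses on the planar data `(w, g)` of ONE time slice `u[w,g]` of
Scheffer's block (Scheffer 1985, Lemma 2.1, (2.2)–(2.5) and (2.9) at a fixed time `t`, with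
`w = Sᵢvᵢ`, `g = qᵢ,ₜ`; Ożański 2017, (4.19) for `(aᵢᵏ(t)vᵢ, qᵏᵢ,ₜ)`): `U` relatively compact
in the open half-plane `P`, `w ∈ C^∞` with `supp w ⊆ U`, `g ∈ C^∞`, `g ≥ 0`, `g = 0` off `Ū`
((2.4)), `g > |w|` on `U` ((2.5), in Ożański's form "in `Uᵢ`"), and `div(x₂ w) = 0` on `U`
((2.9)). Satisfied by every structure (`IsNSIStructure.isNSISlice`) and by every time slice of
profile data (`IsNSIProfileData.slice₁`, `….slice₂`).
[cite: Scheffer1985, Lemma 2.1 (2.2)–(2.5) and (2.9)] -/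
structure IsNSISlice (U : Set (ℝ × ℝ)) (w : ℝ × ℝ → ℝ × ℝ) (g : ℝ × ℝ → ℝ) : Prop where
  /-- `Ū` is compact, -/
  isCompact_closure : IsCompact (closure U)
  /-- `Ū ⊆ P` (Scheffer (2.2): `Cᵢ ⊆ P` compact). -/
  closure_subset : closure U ⊆ halfPlane
  /-- `w` is smooth (Scheffer (2.3)). -/
  w_smooth : ContDiff ℝ ∞ w
  /-- `g` is smooth (Scheffer (2.3)). -/
  g_smooth : ContDiff ℝ ∞ g
  /-- `g ≥ 0` (Scheffer (2.3)). -/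
  g_nonneg : ∀ q, 0 ≤ g q
  /-- `supp w ⊆ U` (Scheffer (2.3): `spt vᵢ ⊆ C'ᵢ`). -/
  tsupport_w : tsupport w ⊆ U
  /-- `g = 0` off `Ū` (Scheffer (2.4)). -/
  g_eq_zero : ∀ q ∉ closure U, g q = 0
  /-- `g > |w|` on `U` (Scheffer (2.5); Ożański (4.19)). -/
  sq_lt : ∀ q ∈ U, (w q).1 ^ 2 + (w q).2 ^ 2 < g q ^ 2
  /-- `div(x₂ w) = 0` on `U` (Scheffer (2.9)). -/
  div_eq_zero : ∀ q ∈ U,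
    derivR (fun q' : ℝ × ℝ => q'.1 * (w q').1) q + derivZ (fun q' : ℝ × ℝ => q'.1 * (w q').2) q = 0

/-- A structure is slice data. [cite: Ozanski2017NSISingular, Definition 3.3] -/
theorem IsNSIStructure.isNSISlice {U : Set (ℝ × ℝ)} {v : ℝ × ℝ → ℝ × ℝ} {f φ : ℝ × ℝ → ℝ}
    (h : IsNSIStructure U v f φ) : IsNSISlice U v f where
  isCompact_closure := h.isCompact_closure
  closure_subset := h.closure_subset
  w_smooth := h.v_smooth
  g_smooth := h.f_smooth
  g_nonneg := h.f_nonneg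
  tsupport_w := h.tsupport_v_subset
  g_eq_zero _ hq := h.f_eq_zero hq
  sq_lt := h.sq_lt
  div_eq_zero := h.div_eq_zero

namespace IsNSISlice

variable {U : Set (ℝ × ℝ)} {w : ℝ × ℝ → ℝ × ℝ} {g : ℝ × ℝ → ℝ}

/-- `w = 0` off `Ū`. [folklore] -/
theorem w_eq_zero (h : IsNSISlice U w g) {q : ℝ × ℝ} (hq : q ∉ closure U) : w q = 0 :=
  image_eq_zero_of_notMem_tsupport fun hq' => hq (subset_closure (h.tsupport_w hq'))

/-- `|w|² ≤ g²` everywhere. [folklore] -/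
theorem sq_le (h : IsNSISlice U w g) (q : ℝ × ℝ) : (w q).1 ^ 2 + (w q).2 ^ 2 ≤ g q ^ 2 := by
  by_cases hq : q ∈ U
  · exact (h.sq_lt q hq).le
  · have : w q = 0 := image_eq_zero_of_notMem_tsupport fun hq' => hq (h.tsupport_w hq')
    simp [this, sq_nonneg]

/-- `g > 0` on `U`. [cite: Ozanski2017NSISingular, §4.1 (4.19)] -/
theorem g_pos (h : IsNSISlice U w g) {q : ℝ × ℝ} (hq : q ∈ U) : 0 < g q := by
  have h1 := h.sq_lt q hq
  rcases (h.g_nonneg q).lt_or_eq with h2 | h2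
  · exact h2
  · rw [← h2] at h1
    nlinarith [sq_nonneg (w q).1, sq_nonneg (w q).2]

/-- `supp g = Ū`. [folklore] -/
theorem tsupport_g (h : IsNSISlice U w g) : tsupport g = closure U := by
  apply Subset.antisymm
  · refine closure_minimal (fun q hq => ?_) isClosed_closure
    by_contra hq'
    exact hq (h.g_eq_zero q hq')
  · exact closure_mono fun q hq => Function.mem_support.2 (h.g_pos hq).ne'

/-- Slice data keep a positive distance from the axis. [folklore] -/
theorem exists_axis_margin (h : IsNSISlice U w g) : ∃ r₀ > 0, ∀ q ∈ closure U, r₀ ≤ q.1 := by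
  rcases (closure U).eq_empty_or_nonempty with hU | hU
  · exact ⟨1, one_pos, fun q hq => by simp [hU] at hq⟩
  · obtain ⟨q₀, hq₀, hmin⟩ := h.isCompact_closure.exists_isMinOn hU continuous_fst.continuousOn
    exact ⟨q₀.1, h.closure_subset hq₀, fun q hq => hmin hq⟩

/-- Below the margin all the data vanish. [folklore] -/
theorem exists_axis_margin' (h : IsNSISlice U w g) :
    ∃ r₀ > 0, ∀ q : ℝ × ℝ, q.1 < r₀ → g q = 0 ∧ w q = 0 := by
  obtain ⟨r₀, hr₀, hr⟩ := h.exists_axis_margin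
  refine ⟨r₀, hr₀, fun q hq => ?_⟩
  have hq' : q ∉ closure U := fun h' => (hr q h').not_gt hq
  exact ⟨h.g_eq_zero q hq', h.w_eq_zero hq'⟩

/-- **The swirl profile `√(g² - |w|²)` is smooth** (positive radicand on `U`; `= g` off
`supp w`). [cite: Ozanski2017NSISingular, §3.3 (after (3.12))] -/
theorem contDiff_sqrt (h : IsNSISlice U w g) :
    ContDiff ℝ ∞ fun q : ℝ × ℝ => Real.sqrt (g q ^ 2 - ((w q).1 ^ 2 + (w q).2 ^ 2)) := by
  have hw1 : ContDiff ℝ ∞ fun q => (w q).1 := contDiff_fst.comp h.w_smooth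
  have hw2 : ContDiff ℝ ∞ fun q => (w q).2 := contDiff_snd.comp h.w_smooth
  have hR : ContDiff ℝ ∞ fun q => g q ^ 2 - ((w q).1 ^ 2 + (w q).2 ^ 2) :=
    (h.g_smooth.pow 2).sub ((hw1.pow 2).add (hw2.pow 2))
  refine contDiff_iff_contDiffAt.2 fun q => ?_
  by_cases hq : q ∈ U
  · exact hR.contDiffAt.sqrt (sub_pos.2 (h.sq_lt q hq)).ne'
  · have hq' : q ∉ tsupport w := fun h' => hq (h.tsupport_w h')
    have heq : (fun q' : ℝ × ℝ => Real.sqrt (g q' ^ 2 - ((w q').1 ^ 2 + (w q').2 ^ 2))) =ᶠ[𝓝 q]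
        g := by
      filter_upwards [(isClosed_tsupport w).isOpen_compl.mem_nhds hq'] with q' hq''
      rw [image_eq_zero_of_notMem_tsupport hq'']
      simp [Real.sqrt_sq (h.g_nonneg q')]
    exact h.g_smooth.contDiffAt.congr_of_eventuallyEq heq

/-- **`u[w,g] ∈ C^∞(ℝ³; ℝ³)`** for slice data (Scheffer (2.12): "`uⁱ` is a `C^∞` function";
Ożański §3.3). [cite: Scheffer1985, Lemma 2.1 (2.12)] -/
theorem contDiff_swirlField (h : IsNSISlice U w g) : ContDiff ℝ ∞ (swirlField w g) := by
  obtain ⟨r₀, hr₀, h0⟩ := h.exists_axis_margin'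
  have hw1 : ContDiff ℝ ∞ fun q => (w q).1 := contDiff_fst.comp h.w_smooth
  have hw2 : ContDiff ℝ ∞ fun q => (w q).2 := contDiff_snd.comp h.w_smooth
  have hα : ContDiff ℝ ∞ fun x : ℝ³ => (w (meridian x)).1 * (meridian x).1⁻¹ :=
    contDiff_comp_meridian_of_eq_zero (G := fun q => (w q).1 * q.1⁻¹)
      (contDiff_mul_inv_fst_of_eq_zero hw1 hr₀ fun q hq => by simp [(h0 q hq).2]) hr₀
      fun q hq => by simp [(h0 q hq).2]
  have hβ : ContDiff ℝ ∞ fun x : ℝ³ => (w (meridian x)).2 :=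
    contDiff_comp_meridian_of_eq_zero (G := fun q => (w q).2) hw2 hr₀
      fun q hq => by simp [(h0 q hq).2]
  have hγ : ContDiff ℝ ∞ fun x : ℝ³ =>
      Real.sqrt (g (meridian x) ^ 2 - ((w (meridian x)).1 ^ 2 + (w (meridian x)).2 ^ 2)) *
        (meridian x).1⁻¹ :=
    contDiff_comp_meridian_of_eq_zero
      (G := fun q => Real.sqrt (g q ^ 2 - ((w q).1 ^ 2 + (w q).2 ^ 2)) * q.1⁻¹)
      (contDiff_mul_inv_fst_of_eq_zero h.contDiff_sqrt hr₀ fun q hq => by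
        simp [(h0 q hq).1, (h0 q hq).2]) hr₀
      fun q hq => by simp [(h0 q hq).1, (h0 q hq).2]
  rw [swirlField_eq_linear]
  exact ((hα.smul contDiff_horizontal).add (hβ.smul contDiff_const)).add (hγ.smul rotGenL.contDiff)

/-- Off `R(Ū)` the slice vanishes. [cite: Scheffer1985, Lemma 2.1 (2.12)] -/
theorem swirlField_eq_zero (h : IsNSISlice U w g) {x : ℝ³} (hx : meridian x ∉ closure U) :
    swirlField w g x = 0 := by
  simp only [swirlField, h.g_eq_zero _ hx, h.w_eq_zero hx]
  simp

/-- **`|u[w,g]| = g∘R⁻¹` everywhere** (Ożański (3.11); on the axis both sides vanish).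
[cite: Ozanski2017NSISingular, §3.3 (3.11)] -/
theorem norm_swirlField_eq (h : IsNSISlice U w g) (x : ℝ³) : ‖swirlField w g x‖ = g (meridian x) := by
  by_cases hx : cylRadius x = 0
  · have hq : meridian x ∉ closure U := fun h' => (h.closure_subset h').ne' hx
    rw [h.swirlField_eq_zero hq, norm_zero, h.g_eq_zero _ hq]
  · exact norm_swirlField hx (h.g_nonneg _) (h.sq_le _)

/-- **`supp u[w,g] = R(supp g) = R(Ū)`** (Scheffer (2.12): `uⁱ(x,t) = 0` if `x ∉ R(Cᵢ)`;
Ożański Prop. 4.2 (i): `supp u(t) = G`). [cite: Ozanski2017NSISingular, Prop. 4.2 (i)] -/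
theorem tsupport_swirlField (h : IsNSISlice U w g) : tsupport (swirlField w g) = revolve (closure U) := by
  have hs : support (swirlField w g) = revolve (support g) := by
    ext x
    simp only [mem_support, mem_revolve, ne_eq, ← norm_eq_zero (a := swirlField w g x),
      h.norm_swirlField_eq x]
  rw [tsupport, hs, closure_revolve_eq, ← tsupport, h.tsupport_g]
  intro q hq
  by_contra h'
  have : q ∉ closure U := fun h'' => h' (le_of_lt (show (0 : ℝ) < q.1 from h.closure_subset h''))
  exact hq (h.g_eq_zero q this)

/-- `u[w,g]` has compact support. [cite: Scheffer1985, Lemma 2.1 (2.12)–(2.13)] -/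
theorem hasCompactSupport_swirlField (h : IsNSISlice U w g) : HasCompactSupport (swirlField w g) := by
  rw [HasCompactSupport, h.tsupport_swirlField]
  exact isCompact_revolve h.isCompact_closure

/-- **`div u[w,g] = 0`** for slice data (Ożański Lemma 3.1 (i) with `div(x₂w) = 0`; off `U`
the field `w` vanishes identically near the point, near the axis `u ≡ 0`).
[cite: Ozanski2017NSISingular, Lemma 3.1 (i)] [cite: Scheffer1985, Lemma 2.1 (2.24)] -/
theorem isDivFree_swirlField (h : IsNSISlice U w g) : VectorCalculus.IsDivFree (swirlField w g) := by
  intro x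
  obtain ⟨r₀, hr₀, hr⟩ := h.exists_axis_margin
  by_cases hx : cylRadius x < r₀
  · apply divergence_eq_zero_of_notMem_tsupport
    rw [h.tsupport_swirlField]
    exact fun hx' => (hr _ hx').not_gt hx
  · have hx0 : cylRadius x ≠ 0 := fun h0 => hx (h0 ▸ hr₀)
    set q := meridian x with hq
    have hwd : Differentiable ℝ w := h.w_smooth.differentiable (by simp)
    have hw1 : DifferentiableAt ℝ (fun q' => (w q').1) q := differentiableAt_fst.comp _ (hwd q)
    have hw2 : DifferentiableAt ℝ (fun q' => (w q').2) q := differentiableAt_snd.comp _ (hwd q)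
    rw [divergence_swirlField hx0 (hwd q) (h.contDiff_sqrt.differentiable (by simp) q)]
    by_cases hqU : q ∈ U
    · have key := h.div_eq_zero q hqU
      simp only [derivR, derivZ] at key ⊢
      rw [fderiv_fun_mul differentiableAt_fst hw1, fderiv_fun_mul differentiableAt_fst hw2,
        fderiv_fst] at key
      have hq1 : q.1 = cylRadius x := rfl
      have hq0 : q.1 ≠ 0 := hq1 ▸ hx0
      rw [← hq1]
      simp at key
      field_simp
      linear_combination key
    · have hq' : q ∉ tsupport w := fun h' => hqU (h.tsupport_w h')
      have hw0 : ∀ᶠ q' in 𝓝 q, w q' = 0 := by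
        filter_upwards [(isClosed_tsupport w).isOpen_compl.mem_nhds hq'] with q' hq''
        exact image_eq_zero_of_notMem_tsupport hq''
      have e1 : (fun q' => (w q').1) =ᶠ[𝓝 q] fun _ => (0 : ℝ) := hw0.mono fun q' hq'' => by
        simp [hq'']
      have e2 : (fun q' => (w q').2) =ᶠ[𝓝 q] fun _ => (0 : ℝ) := hw0.mono fun q' hq'' => by
        simp [hq'']
      simp only [derivR, derivZ]
      rw [e1.fderiv_eq, e2.fderiv_eq, image_eq_zero_of_notMem_tsupport hq']
      simp

/-- Off `supp w` the slice is locally the pure swirl `g φ̂`. [folklore] -/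
theorem swirlField_eventuallyEq_swirl (h : IsNSISlice U w g) {x : ℝ³} (hq : meridian x ∉ tsupport w) :
    swirlField w g =ᶠ[𝓝 x] fun y => g (meridian y) • eTheta y := by
  have hO : IsOpen ((tsupport w)ᶜ) := (isClosed_tsupport w).isOpen_compl
  filter_upwards [(hO.preimage continuous_meridian).mem_nhds hq] with y hy
  have hw0 : w (meridian y) = 0 := image_eq_zero_of_notMem_tsupport hy
  simp only [swirlField, hw0, Prod.fst_zero, Prod.snd_zero, zero_smul, zero_add]
  rw [show ((0 : ℝ) ^ 2 + (0 : ℝ) ^ 2) = 0 by norm_num, sub_zero, Real.sqrt_sq (h.g_nonneg _)]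

/-- The lifted swirl profile `(g/r)∘R⁻¹` is smooth on `ℝ³`. [folklore] -/
theorem contDiff_comp_meridian_div (h : IsNSISlice U w g) :
    ContDiff ℝ ∞ fun y : ℝ³ => g (meridian y) * (meridian y).1⁻¹ := by
  obtain ⟨r₀, hr₀, h0⟩ := h.exists_axis_margin'
  exact contDiff_comp_meridian_of_eq_zero (G := fun q => g q * q.1⁻¹)
    (contDiff_mul_inv_fst_of_eq_zero h.g_smooth hr₀ fun q hq => (h0 q hq).1) hr₀
    fun q hq => by simp [(h0 q hq).1]

/-- **`Δu[w,g] = (Lg) φ̂` off `supp w`** (off the axis), by Lemma 3.1 (ii) and locality of `Δ`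
(Scheffer (2.20)). [cite: Ozanski2017NSISingular, Lemma 3.1 (ii)] [cite: Scheffer1985, Lemma 2.1 (2.20)] -/
theorem laplacian_swirlField_of_notMem (h : IsNSISlice U w g) {x : ℝ³} (hx : cylRadius x ≠ 0)
    (hq : meridian x ∉ tsupport w) : (Δ (swirlField w g)) x = opL g (meridian x) • eTheta x := by
  rw [(InnerProductSpace.laplacian_congr_nhds (h.swirlField_eventuallyEq_swirl hq)).self_of_nhds]
  exact laplacian_swirl (contDiff_infty.1 h.g_smooth 2) (contDiff_infty.1 h.contDiff_comp_meridian_div 2) hx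

/-- **`u·Δu = g Lg` off `supp w`** (Ożański (3.31); Scheffer (2.20)–(2.22)).
[cite: Ozanski2017NSISingular, §3.4 (3.31)] [cite: Scheffer1985, Lemma 2.1 (2.22)] -/
theorem inner_swirlField_laplacian_eq (h : IsNSISlice U w g) {x : ℝ³} (hx : cylRadius x ≠ 0)
    (hq : meridian x ∉ tsupport w) :
    ⟪swirlField w g x, (Δ (swirlField w g)) x⟫ = g (meridian x) * opL g (meridian x) := by
  have hu : swirlField w g x = g (meridian x) • eTheta x := (h.swirlField_eventuallyEq_swirl hq).self_of_nhds
  have hn : ‖eTheta x‖ ^ 2 = 1 := by simpa using norm_sq_frame hx 0 0 1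
  rw [h.laplacian_swirlField_of_notMem hx hq, hu, real_inner_smul_left, real_inner_smul_right,
    real_inner_self_eq_norm_sq, hn, mul_one]

end IsNSISlice

/-! ### The slices of profile data -/

namespace IsNSIProfileData

variable {U₁ U₂ : Set (ℝ × ℝ)} {v₁ : ℝ × ℝ → ℝ × ℝ} {f₁ φ₁ : ℝ × ℝ → ℝ} {v₂ : ℝ × ℝ → ℝ × ℝ}
  {f₂ φ₂ : ℝ × ℝ → ℝ} {T τ : ℝ} {z : ℝ³} {η δ : ℝ} {C₁ C₂ : Set (ℝ × ℝ)} {a₁ a₂ : ℝ → ℝ}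
  {Q₁ Q₂ : ℝ → ℝ × ℝ → ℝ}

/-- `a(t)²|v|² ≤ |v|²` for `|a| ≤ 1`. [folklore] -/
theorem sq_smul_le {a : ℝ} (ha : |a| ≤ 1) (v : ℝ × ℝ → ℝ × ℝ) (q : ℝ × ℝ) :
    ((a • v) q).1 ^ 2 + ((a • v) q).2 ^ 2 ≤ (v q).1 ^ 2 + (v q).2 ^ 2 := by
  have ha2 : a ^ 2 ≤ 1 := by
    have := abs_le.1 ha
    nlinarith
  have hnn : 0 ≤ (v q).1 ^ 2 + (v q).2 ^ 2 := by positivity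
  calc ((a • v) q).1 ^ 2 + ((a • v) q).2 ^ 2 = a ^ 2 * ((v q).1 ^ 2 + (v q).2 ^ 2) := by simp; ring
    _ ≤ 1 * ((v q).1 ^ 2 + (v q).2 ^ 2) := mul_le_mul_of_nonneg_right ha2 hnn
    _ = (v q).1 ^ 2 + (v q).2 ^ 2 := one_mul _

/-- **The first slice** `(a₁(t)v₁, Q₁(t))`, `t ∈ (-η, T+η)`, is slice data on `U₁`.
[cite: Scheffer1985, Lemma 2.1 (2.2)–(2.5)] [cite: Ozanski2017NSISingular, §4.1 (4.19)–(4.20)] -/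
theorem slice₁ (h : IsNSIProfileData U₁ U₂ v₁ v₂ f₁ f₂ T τ z η δ C₁ C₂ a₁ a₂ Q₁ Q₂)
    (hA : IsNSIArrangement U₁ U₂ v₁ f₁ φ₁ v₂ f₂ φ₂ T τ z) {t : ℝ} (ht : t ∈ Ioo (-η) (T + η)) :
    IsNSISlice U₁ (a₁ t • v₁) (Q₁ t) where
  isCompact_closure := hA.structure₁.isCompact_closure
  closure_subset := hA.structure₁.closure_subset
  w_smooth := (hA.structure₁.smul (h.abs_a₁_le t)).v_smooth
  g_smooth := IsSmoothSpaceTimeOn.contDiff_slice h.Q₁_smooth ht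
  g_nonneg := h.Q₁_nonneg t ht
  tsupport_w := ((tsupport_smul_subset_right (fun _ : ℝ × ℝ => a₁ t) v₁).trans h.tsupport_v₁).trans
    h.subset₁
  g_eq_zero := h.Q₁_eq_zero t ht
  sq_lt q hq := (sq_smul_le (h.abs_a₁_le t) v₁ q).trans_lt (h.sq_lt₁ t ht q hq)
  div_eq_zero := (hA.structure₁.smul (h.abs_a₁_le t)).div_eq_zero

/-- **The second slice** `(a₂(t)v₂, Q₂(t))`, `t ∈ (-η, T+η)`, is slice data on `U₂`.
[cite: Scheffer1985, Lemma 2.1 (2.2)–(2.5)] [cite: Ozanski2017NSISingular, §4.1 (4.19)–(4.20)] -/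
theorem slice₂ (h : IsNSIProfileData U₁ U₂ v₁ v₂ f₁ f₂ T τ z η δ C₁ C₂ a₁ a₂ Q₁ Q₂)
    (hA : IsNSIArrangement U₁ U₂ v₁ f₁ φ₁ v₂ f₂ φ₂ T τ z) {t : ℝ} (ht : t ∈ Ioo (-η) (T + η)) :
    IsNSISlice U₂ (a₂ t • v₂) (Q₂ t) where
  isCompact_closure := hA.structure₂.isCompact_closure
  closure_subset := hA.structure₂.closure_subset
  w_smooth := (hA.structure₂.smul (h.abs_a₂_le t)).v_smooth
  g_smooth := IsSmoothSpaceTimeOn.contDiff_slice h.Q₂_smooth ht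
  g_nonneg := h.Q₂_nonneg t ht
  tsupport_w := ((tsupport_smul_subset_right (fun _ : ℝ × ℝ => a₂ t) v₂).trans h.tsupport_v₂).trans
    h.subset₂
  g_eq_zero := h.Q₂_eq_zero t ht
  sq_lt q hq := (sq_smul_le (h.abs_a₂_le t) v₂ q).trans_lt (h.sq_lt₂ t ht q hq)
  div_eq_zero := (hA.structure₂.smul (h.abs_a₂_le t)).div_eq_zero

/-- **`u ∈ C^∞(ℝ³ × (-η, T+η))`**: the field of the block is jointly smooth on the open slab
(Ożański §4.2, first paragraph; Scheffer (2.12)).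
[cite: Ozanski2017NSISingular, §4.2 (first paragraph)] [cite: Scheffer1985, Lemma 2.1 (2.12)] -/
theorem isSmoothSpaceTimeOn_profileField
    (h : IsNSIProfileData U₁ U₂ v₁ v₂ f₁ f₂ T τ z η δ C₁ C₂ a₁ a₂ Q₁ Q₂)
    (hA : IsNSIArrangement U₁ U₂ v₁ f₁ φ₁ v₂ f₂ φ₂ T τ z) :
    IsSmoothSpaceTimeOn (Ioo (-η) (T + η)) (profileField v₁ v₂ a₁ a₂ Q₁ Q₂) :=
  (isSmoothSpaceTimeOn_swirlField_param hA.structure₁.isCompact_closure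
      hA.structure₁.closure_subset hA.structure₁.v_smooth (h.tsupport_v₁.trans h.subset₁)
      h.a₁_smooth h.abs_a₁_le h.Q₁_smooth h.Q₁_nonneg h.Q₁_eq_zero h.sq_lt₁).add
    (isSmoothSpaceTimeOn_swirlField_param hA.structure₂.isCompact_closure
      hA.structure₂.closure_subset hA.structure₂.v_smooth (h.tsupport_v₂.trans h.subset₂)
      h.a₂_smooth h.abs_a₂_le h.Q₂_smooth h.Q₂_nonneg h.Q₂_eq_zero h.sq_lt₂)

end IsNSIProfileData

end Literature.Barriers.NavierStokesRegularity
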